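import Literature.Dynamics.FixedPoints.UnstableSetNull
import Literature.Dynamics.TopologicalDynamics.LimitSetFiniteConvergence
import HarnessLib

/-!
# The stable set of a hyperbolic fixed point with an expanding direction is Lebesgue-null, and
# almost every backward trajectory converges to a source — unconditional forms

Topic `Literature/Dynamics/FixedPoints`.  Everything here is PROVED (no named fact).

HISTORY / DEDUP NOTE.  The first accepted version of this module (p555836) also proved the cone lemma of
the Hadamard–Perron theorem and the unconditional `addHaar_unstableSet_eq_zero`; the SAME results had been
accepted two minutes earlier in the sibling `UnstableSetNull.lean` (p555452: `norm_projection_stable_le_of_pastHistories`,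
`hausdorffMeasure_localUnstableSet_eq_zero`, `addHaar_unstableSet_eq_zero`, `addHaar_setOf_tendsto_atBot_eq_zero`).
This version REMOVES every duplicated declaration (none had importers) and keeps only the complement,
re-derived from `UnstableSetNull.lean`: together the two files give, WITHOUT the hypothesis
`(hSMT : Robinson1999_stableManifoldTheorem)`, every consumer-facing corollary of the fact file
`StableManifoldTheorem.lean`.

* `IsHyperbolicSplitting.of_inverse` — the inverse of a hyperbolic operator (finite dimensions) is
  hyperbolic with the stable and unstable subspaces exchanged (Katok–Hasselblatt §1.2);
* `IsHyperbolicSplitting.addHaar_stableSet_eq_zero` — for `f ∈ C¹(E)` with a `C¹` left inverse, `f p = p`,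
  `IsHyperbolicSplitting (Df p) Es Eu`, `Es ≠ ⊤`: `{q : f^j q → p}` is Lebesgue-null (the forward orbit is a
  past history for the inverse, whose derivative has unstable subspace `Es`; Brin–Stuck Thm 5.6.4 /
  Prop. 5.6.5 for `f⁻¹`) — unconditional twin of `Robinson1999_stableManifoldTheorem.addHaar_stableSet_eq_zero`;
* `IsHyperbolicSplitting.addHaar_setOf_tendsto_atTop_eq_zero` — flows: points converging FORWARD to a
  hyperbolic equilibrium with an expanding direction form a null set (time-one map `Φ 1`, inverse `Φ (−1)`);
* `IsHyperbolicSplitting.ae_tendsto_atBot_source`, `…_of_mapClusterPt` — with finitely many equilibria, the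
  non-sources hyperbolic with a contracting direction, almost every point whose backward trajectory converges
  to (resp. accumulates only at) equilibria converges backward to a SOURCE — same statements as
  `Robinson1999_stableManifoldTheorem.ae_tendsto_atBot_source(_of_mapClusterPt)` minus `hSMT`.

## References

* M. Brin, G. Stuck, *Introduction to Dynamical Systems*, CUP (2002), §5.6 Thm 5.6.4, Prop. 5.6.5,
  §5.7 (cones). [BrinStuck2002]
* A. Katok, B. Hasselblatt, *Introduction to the Modern Theory of Dynamical Systems*, CUP (1995),
  §1.2 (hyperbolic linear maps), §6.2 (Hadamard–Perron). [KatokHasselblatt1995]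
* C. Robinson, *Dynamical Systems*, 2nd ed., CRC (1999), Ch. V §5.10 Thm 10.1, §5.10.3, Thm 4.1 (d).
  [Robinson1999]
-/

noncomputable section

open Filter Set Function Topology MeasureTheory Metric

namespace Literature.Dynamics.FixedPoints

/-! ### The stable set of a `C¹` map with a `C¹` left inverse at a hyperbolic fixed point is null -/

section Null

universe u

variable {E : Type u} [NormedAddCommGroup E] [NormedSpace ℝ E] [FiniteDimensional ℝ E]
  [MeasurableSpace E] [BorelSpace E]

omit [MeasurableSpace E] [BorelSpace E] in
/-- **The inverse of a hyperbolic operator is hyperbolic with stable and unstable subspaces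
exchanged** (finite dimensions): if `L' ∘ L = id = L ∘ L'` and `L` has the hyperbolic splitting
`Es ⊕ Eu`, then `L'` has the hyperbolic splitting `Eu ⊕ Es`.
[cite: KatokHasselblatt1995, §1.2 (hyperbolic linear maps: the inverse is hyperbolic with E^s and E^u exchanged)] -/
theorem IsHyperbolicSplitting.of_inverse {L L' : E →L[ℝ] E} {Es Eu : Submodule ℝ E}
    (hL : IsHyperbolicSplitting L Es Eu) (h₁ : ∀ x, L' (L x) = x) (h₂ : ∀ x, L (L' x) = x) :
    IsHyperbolicSplitting L' Eu Es := by
  -- `L'` preserves both subspaces: `L` restricted to an invariant finite-dimensional subspace is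
  -- injective, hence surjective onto it
  have hsurj : ∀ (S : Submodule ℝ E), (∀ x ∈ S, L x ∈ S) → ∀ x ∈ S, L' x ∈ S := by
    intro S hS x hx
    -- the restriction of `L` to `S`
    let T : S →ₗ[ℝ] S := (L.toLinearMap.restrict fun y hy => hS y hy)
    have hTinj : Function.Injective T := by
      intro a b hab
      have : (L a : E) = L b := by
        simpa [T, LinearMap.restrict_apply] using congrArg Subtype.val hab
      ext
      simpa [h₁] using congrArg L' this
    obtain ⟨y, hy⟩ := (LinearMap.injective_iff_surjective.1 hTinj) ⟨x, hx⟩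
    have hy' : L (y : E) = x := by
      simpa [T, LinearMap.restrict_apply] using congrArg Subtype.val hy
    have : L' x = y := by rw [← hy', h₁]
    rw [this]; exact y.2
  have hpow : ∀ (n : ℕ) (x : E), (L ^ n) ((L' ^ n) x) = x := by
    intro n
    induction n with
    | zero => intro x; simp
    | succ n ih =>
        intro x
        rw [pow_succ' L n, pow_succ L' n, mul_apply_eq_comp, mul_apply_eq_comp, ih, h₂]
  obtain ⟨n₁, hn₁⟩ := hL.eventually_contracting
  obtain ⟨n₂, hn₂⟩ := hL.eventually_expanding
  have hS' : ∀ x ∈ Es, L' x ∈ Es := hsurj Es hL.mapsTo_stable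
  have hU' : ∀ x ∈ Eu, L' x ∈ Eu := hsurj Eu hL.mapsTo_unstable
  refine
    { isClosed_stable := hL.isClosed_unstable
      isClosed_unstable := hL.isClosed_stable
      isCompl := hL.isCompl.symm
      mapsTo_stable := hU'
      mapsTo_unstable := hS'
      finiteDimensional_unstable := inferInstance
      eventually_contracting := ⟨n₂, fun x hx => ?_⟩
      eventually_expanding := ⟨n₁, fun x hx => ?_⟩ }
  · -- `x ∈ Eu`: `2‖L'^n x‖ ≤ ‖L^n L'^n x‖ = ‖x‖`
    have hmem : (L' ^ n₂) x ∈ Eu := by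
      rw [ContinuousLinearMap.coe_pow']; exact (MapsTo.iterate hU' n₂) hx
    have := hn₂ _ hmem
    rw [hpow] at this
    linarith
  · -- `x ∈ Es`: `‖x‖ = ‖L^n L'^n x‖ ≤ ½‖L'^n x‖`
    have hmem : (L' ^ n₁) x ∈ Es := by
      rw [ContinuousLinearMap.coe_pow']; exact (MapsTo.iterate hS' n₁) hx
    have := hn₁ _ hmem
    rw [hpow] at this
    linarith

/-- **The stable set of a hyperbolic fixed point with a proper stable subspace is Lebesgue-null,
for a `C¹` map with a `C¹` left inverse** (unconditional form of
`Robinson1999_stableManifoldTheorem.addHaar_stableSet_eq_zero`).  If `g ∘ f = id` with `f, g ∈ C¹(E)`,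
`f p = p`, `Df(p)` hyperbolic with splitting `Es ⊕ Eu` and `Es ≠ E`, then `{q : f^j(q) → p}` has
measure zero: the forward orbit `(f^j q)` is a past history of `q` under `g` converging to `p`, and
`Dg(p) = Df(p)⁻¹` is hyperbolic with unstable subspace `Es`.
[cite: BrinStuck2002, §5.6 Thm 5.6.4 and Prop. 5.6.5] -/
theorem IsHyperbolicSplitting.addHaar_stableSet_eq_zero (μ : Measure E) [μ.IsAddHaarMeasure]
    {f g : E → E} (hf : ContDiff ℝ 1 f) (hg : ContDiff ℝ 1 g) (hgf : ∀ x, g (f x) = x)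
    {p : E} (hp : f p = p) {Es Eu : Submodule ℝ E}
    (hL : IsHyperbolicSplitting (fderiv ℝ f p) Es Eu) (hEs : Es ≠ ⊤) :
    μ {q | Tendsto (fun j => f^[j] q) atTop (𝓝 p)} = 0 := by
  have hgp : g p = p := by conv_lhs => rw [← hp]; exact hgf p
  -- `Dg(p) ∘ Df(p) = id = Df(p) ∘ Dg(p)`
  have hfd : HasFDerivAt f (fderiv ℝ f p) p := (hf.differentiable one_ne_zero p).hasFDerivAt
  have hgd : HasFDerivAt g (fderiv ℝ g p) p := (hg.differentiable one_ne_zero p).hasFDerivAt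
  have hcomp : (fderiv ℝ g p).comp (fderiv ℝ f p) = ContinuousLinearMap.id ℝ E := by
    have h1 : HasFDerivAt (g ∘ f) ((fderiv ℝ g p).comp (fderiv ℝ f p)) p := by
      have hgd' : HasFDerivAt g (fderiv ℝ g p) (f p) := by rw [hp]; exact hgd
      exact hgd'.comp p hfd
    have h2 : HasFDerivAt (g ∘ f) (ContinuousLinearMap.id ℝ E) p := by
      have : (g ∘ f) = id := funext hgf
      rw [this]; exact hasFDerivAt_id p
    exact h1.unique h2
  have h₁ : ∀ x, fderiv ℝ g p (fderiv ℝ f p x) = x := fun x => by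
    simpa using congrArg (fun T : E →L[ℝ] E => T x) hcomp
  have h₂ : ∀ x, fderiv ℝ f p (fderiv ℝ g p x) = x := by
    -- a left-invertible endomorphism of a finite-dimensional space is surjective
    have hinj : Function.Injective (fderiv ℝ f p : E →ₗ[ℝ] E) :=
      fun a b hab => by simpa [h₁] using congrArg (fderiv ℝ g p) hab
    have hsurj : Function.Surjective (fderiv ℝ f p : E →ₗ[ℝ] E) :=
      LinearMap.injective_iff_surjective.1 hinj
    intro x
    obtain ⟨y, hy⟩ := hsurj x
    rw [ContinuousLinearMap.coe_coe] at hy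
    rw [← hy, h₁]
  have hL' : IsHyperbolicSplitting (fderiv ℝ g p) Eu Es := hL.of_inverse h₁ h₂
  refine measure_mono_null (fun q hq => ?_) (addHaar_unstableSet_eq_zero μ hg hgp hL' hEs)
  exact ⟨fun j => f^[j] q, rfl, fun j => by simp only [Function.iterate_succ_apply', hgf], hq⟩

end Null

/-! ### Flows: forward convergence to an equilibrium with an expanding direction; sources -/

section Flow

universe v

variable {E : Type v} [NormedAddCommGroup E] [NormedSpace ℝ E] [FiniteDimensional ℝ E]
  [MeasurableSpace E] [BorelSpace E]

/-- **Flows: the set of points converging forward to a hyperbolic equilibrium with an expanding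
direction is Lebesgue-null** (time-one map `Φ 1`, inverse `Φ (-1)`; unconditional form of
`Robinson1999_stableManifoldTheorem.addHaar_setOf_tendsto_atTop_eq_zero`).
[cite: BrinStuck2002, §5.6 Thm 5.6.4 (via the time-one map)] -/
theorem IsHyperbolicSplitting.addHaar_setOf_tendsto_atTop_eq_zero (μ : Measure E)
    [μ.IsAddHaarMeasure] {Φ : ℝ → E → E} (hΦ0 : ∀ y, Φ 0 y = y)
    (hΦ : ∀ s t y, Φ (s + t) y = Φ s (Φ t y)) (h1 : ContDiff ℝ 1 (Φ 1))
    (h1' : ContDiff ℝ 1 (Φ (-1))) {p : E} (hp : Φ 1 p = p) {Es Eu : Submodule ℝ E}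
    (hL : IsHyperbolicSplitting (fderiv ℝ (Φ 1) p) Es Eu) (hEs : Es ≠ ⊤) :
    μ {y | Tendsto (fun s => Φ s y) atTop (𝓝 p)} = 0 := by
  have hinv : ∀ x, Φ (-1) (Φ 1 x) = x := fun x => by rw [← hΦ]; norm_num [hΦ0]
  refine measure_mono_null (fun y hy => ?_)
    (hL.addHaar_stableSet_eq_zero μ h1 h1' hinv hp hEs)
  show Tendsto (fun j => (Φ 1)^[j] y) atTop (𝓝 p)
  have hit : ∀ j : ℕ, (Φ 1)^[j] y = Φ (j : ℝ) y := by
    intro j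
    induction j with
    | zero => simpa using (hΦ0 y).symm
    | succ n ih =>
        rw [Function.iterate_succ_apply', ih, ← hΦ]
        push_cast
        ring_nf
  rw [show (fun j : ℕ => (Φ 1)^[j] y) = fun j : ℕ => Φ (j : ℝ) y from funext hit]
  exact (hy : Tendsto (fun s => Φ s y) atTop (𝓝 p)).comp tendsto_natCast_atTop_atTop

/-- **Almost every point converges backward to a source** (unconditional form of
`Robinson1999_stableManifoldTheorem.ae_tendsto_atBot_source`).  `Φ` a one-parameter group on `E`
with `C¹` time-one map, `N` a finite set of fixed points of `Φ 1`, `S ⊆ N` ("sources") such that at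
every `p ∈ N \ S` the derivative `D(Φ 1)(p)` is hyperbolic with a proper unstable subspace.  If
every point's backward trajectory converges to a point of `N`, then for a.e. `y` it converges to a
point of `S`. [cite: BrinStuck2002, §5.6 Thm 5.6.4 (via the time-one map)] -/
theorem IsHyperbolicSplitting.ae_tendsto_atBot_source (μ : Measure E) [μ.IsAddHaarMeasure]
    {Φ : ℝ → E → E} (hΦ0 : ∀ y, Φ 0 y = y) (hΦ : ∀ s t y, Φ (s + t) y = Φ s (Φ t y))
    (h1 : ContDiff ℝ 1 (Φ 1)) {N S : Set E} (hN : N.Finite) (hfix : ∀ p ∈ N, Φ 1 p = p)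
    (hhyp : ∀ p ∈ N \ S, ∃ Es Eu : Submodule ℝ E,
      IsHyperbolicSplitting (fderiv ℝ (Φ 1) p) Es Eu ∧ Eu ≠ ⊤)
    (hconv : ∀ y, ∃ p ∈ N, Tendsto (fun s => Φ s y) atBot (𝓝 p)) :
    ∀ᵐ y ∂μ, ∃ p ∈ S, Tendsto (fun s => Φ s y) atBot (𝓝 p) := by
  rw [ae_iff]
  have hsub : {y | ¬ ∃ p ∈ S, Tendsto (fun s => Φ s y) atBot (𝓝 p)} ⊆
      ⋃ p ∈ N \ S, {y | Tendsto (fun s => Φ s y) atBot (𝓝 p)} := by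
    intro y hy
    obtain ⟨p, hpN, hp⟩ := hconv y
    have hpS : p ∉ S := fun hpS => hy ⟨p, hpS, hp⟩
    exact mem_biUnion (show p ∈ N \ S from ⟨hpN, hpS⟩) hp
  refine measure_mono_null hsub ((measure_biUnion_null_iff (hN.subset sdiff_subset).countable).2
    fun p hp => ?_)
  obtain ⟨Es, Eu, hL, hEu⟩ := hhyp p hp
  exact addHaar_setOf_tendsto_atBot_eq_zero μ hΦ0 hΦ h1 (hfix p hp.1) hL hEu

/-- **Almost every bounded backward trajectory converges to a source** (unconditional form of
`Robinson1999_stableManifoldTheorem.ae_tendsto_atBot_source_of_mapClusterPt`): as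
`ae_tendsto_atBot_source`, with the convergence hypothesis replaced by its dynamical source —
every backward trajectory is continuous, eventually stays in a compact set, and has all its
cluster points at `−∞` in the finite set `N` (`exists_tendsto_atBot_of_mapClusterPt_mem_finite`).
[cite: BrinStuck2002, §5.6 Thm 5.6.4 (via the time-one map)] -/
theorem IsHyperbolicSplitting.ae_tendsto_atBot_source_of_mapClusterPt (μ : Measure E)
    [μ.IsAddHaarMeasure] {Φ : ℝ → E → E} (hΦ0 : ∀ y, Φ 0 y = y)
    (hΦ : ∀ s t y, Φ (s + t) y = Φ s (Φ t y)) (h1 : ContDiff ℝ 1 (Φ 1))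
    (hcont : ∀ y, Continuous fun s => Φ s y) {N S : Set E} (hN : N.Finite)
    (hfix : ∀ p ∈ N, Φ 1 p = p)
    (hhyp : ∀ p ∈ N \ S, ∃ Es Eu : Submodule ℝ E,
      IsHyperbolicSplitting (fderiv ℝ (Φ 1) p) Es Eu ∧ Eu ≠ ⊤)
    (hbdd : ∀ y, ∃ K : Set E, IsCompact K ∧ ∀ᶠ s in atBot, Φ s y ∈ K)
    (hcl : ∀ y x, MapClusterPt x atBot (fun s => Φ s y) → x ∈ N) :
    ∀ᵐ y ∂μ, ∃ p ∈ S, Tendsto (fun s => Φ s y) atBot (𝓝 p) := by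
  refine IsHyperbolicSplitting.ae_tendsto_atBot_source μ hΦ0 hΦ h1 hN hfix hhyp fun y => ?_
  obtain ⟨K, hK, hyK⟩ := hbdd y
  exact TopologicalDynamics.exists_tendsto_atBot_of_mapClusterPt_mem_finite (hcont y) hK hyK hN
    (hcl y)

end Flow

end Literature.Dynamics.FixedPoints
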